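import Literature.NumberTheory.Transcendental.KZCubicalCalculus
import Literature.NumberTheory.Transcendental.NashCubes

/-!
# `PentagonInKZ`, line `edge-normal-newton-leibniz`: corner engine — coordinate blocks under permutations

Bookkeeping for the proof of `cornerEngine_uniformlyNull` (crux `FurushoPentagon.PentagonInKZ`,
stmt-KontsevichZagierPeriods-11348).  A point of the cube `[0,1]^{k+l+e}` carries three blocks
`x | y | θ` (horizontal variables, vertical variables, parameters), read off through
`Fin.castAdd` / `Fin.natAdd`.  The engine permutes coordinates in four ways — re-association of
`k+l+e`, moving the outermost variable `x₀` to the last (parameter) slot, exchanging the two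
variable blocks, exchanging two parameters — and this file records the effect of each on the
three blocks (`comp_cast_blocks`, `rot_blocks`, `swapBlocks_blocks`, `swap_params_blocks`).

References: [KontsevichZagier2001, §1.2 rule (2)] (coordinate permutations are volume preserving).
-/

noncomputable section

open Set
open Literature.NumberTheory.Transcendental

namespace Summit.KontsevichZagierPeriods.FurushoPentagon.PentagonInKZ

namespace CornerBlocks

section Blocks

variable {k l e : ℕ}

/-- **Re-association**: composing with `Fin.cast` re-brackets the three blocks. [folklore] -/
theorem comp_cast_blocks {k' l' e' : ℕ} (hk : k = k') (hl : l = l') (he : e = e')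
    (H : k + l + e = k' + l' + e') (w : Fin (k' + l' + e') → ℝ) :
    (fun i : Fin k => w (Fin.cast H (Fin.castAdd e (Fin.castAdd l i)))) =
        (fun i : Fin k => w (Fin.castAdd e' (Fin.castAdd l' (Fin.cast hk i)))) ∧
      (fun j : Fin l => w (Fin.cast H (Fin.castAdd e (Fin.natAdd k j)))) =
        (fun j : Fin l => w (Fin.castAdd e' (Fin.natAdd k' (Fin.cast hl j)))) ∧
      (fun s : Fin e => w (Fin.cast H (Fin.natAdd (k + l) s))) =
        (fun s : Fin e => w (Fin.natAdd (k' + l') (Fin.cast he s))) := by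
  subst hk hl he
  refine ⟨?_, ?_, ?_⟩ <;> funext i <;> congr 1

/-- **Moving the outermost variable to the last slot**: for the permutation
`ε = (Fin.cast h).trans (finRotate _).symm : Fin ((k+1)+l+e) ≃ Fin (k+l+(e+1))`, the blocks of
`z = w ∘ ε` are `x = x₀ :: x'`, `y`, `θ = init θ'` where `w` has blocks `x' | y | θ'` and
`x₀ = θ'_{last}`. [folklore] -/
theorem rot_blocks (h : k + 1 + l + e = k + l + e + 1) (w : Fin (k + l + (e + 1)) → ℝ) :
    (fun i : Fin (k + 1) => w ((finRotate (k + l + e + 1)).symm (Fin.cast h (Fin.castAdd e (Fin.castAdd l i))))) =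
        Fin.cons (w (Fin.natAdd (k + l) (Fin.last e))) (fun i : Fin k => w (Fin.castAdd (e + 1) (Fin.castAdd l i))) ∧
      (fun j : Fin l => w ((finRotate (k + l + e + 1)).symm (Fin.cast h (Fin.castAdd e (Fin.natAdd (k + 1) j))))) =
        (fun j : Fin l => w (Fin.castAdd (e + 1) (Fin.natAdd k j))) ∧
      (fun s : Fin e => w ((finRotate (k + l + e + 1)).symm (Fin.cast h (Fin.natAdd (k + 1 + l) s)))) =
        (fun s : Fin e => w (Fin.natAdd (k + l) (Fin.castSucc s))) := by
  -- `w ∘ (finRotate _).symm = Fin.cons (w last) (w ∘ castSucc)`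
  have key : ∀ i : Fin (k + l + e + 1),
      w ((finRotate (k + l + e + 1)).symm i) =
        (Fin.cons (w (Fin.last (k + l + e))) (fun j : Fin (k + l + e) => w (Fin.castSucc j)) :
          Fin (k + l + e + 1) → ℝ) i := by
    intro i
    have hw : ∀ j : Fin (k + l + e + 1),
        w j = Fin.snoc (α := fun _ => ℝ) (fun j : Fin (k + l + e) => w (Fin.castSucc j))
          (w (Fin.last (k + l + e))) j := by
      intro j
      refine Fin.lastCases ?_ (fun j' => ?_) j
      · rw [Fin.snoc_last]
      · rw [Fin.snoc_castSucc]
    rw [hw ((finRotate (k + l + e + 1)).symm i), Fin.snoc_eq_cons_rotate]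
    simp only [Equiv.apply_symm_apply]
  refine ⟨?_, ?_, ?_⟩
  · funext i
    rw [key]
    refine Fin.cases ?_ (fun i' => ?_) i
    · have : Fin.cast h (Fin.castAdd e (Fin.castAdd l (0 : Fin (k + 1)))) = 0 := Fin.ext rfl
      rw [this, Fin.cons_zero, Fin.cons_zero]
      rfl
    · have : Fin.cast h (Fin.castAdd e (Fin.castAdd l i'.succ)) =
          Fin.succ (Fin.castAdd e (Fin.castAdd l i')) := Fin.ext rfl
      rw [this, Fin.cons_succ, Fin.cons_succ]
      rfl
  · funext j
    rw [key]
    have : Fin.cast h (Fin.castAdd e (Fin.natAdd (k + 1) j)) =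
        Fin.succ (Fin.castAdd e (Fin.natAdd k j)) := Fin.ext (by simp; omega)
    rw [this, Fin.cons_succ]
    rfl
  · funext s
    rw [key]
    have : Fin.cast h (Fin.natAdd (k + 1 + l) s) =
        Fin.succ (Fin.natAdd (k + l) s) := Fin.ext (by simp; omega)
    rw [this, Fin.cons_succ]
    rfl

/-- Membership in the open cube is invariant under coordinate permutations. [folklore] -/
theorem comp_equiv_mem_openUnitCube_iff {a b : ℕ} (ε : Fin a ≃ Fin b) (w : Fin b → ℝ) :
    (fun i => w (ε i)) ∈ openUnitCube a ↔ w ∈ openUnitCube b := by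
  constructor
  · intro h j; simpa using h (ε.symm j)
  · intro h i; exact h (ε i)

/-- Membership in the closed cube is invariant under coordinate permutations. [folklore] -/
theorem comp_equiv_mem_cube_iff {a b : ℕ} (ε : Fin a ≃ Fin b) (w : Fin b → ℝ) :
    (fun i => w (ε i)) ∈ KZ.cube a ↔ w ∈ KZ.cube b := by
  rw [KZ.mem_cube, KZ.mem_cube]
  constructor
  · intro h j; simpa using h (ε.symm j)
  · intro h i; exact h (ε i)

/-- **Exchanging the two variable blocks**: for
`ε = finSumFinEquiv ∘ (sumComm ⊕ id) ∘ finSumFinEquiv⁻¹ : Fin (k+l+e) ≃ Fin (l+k+e)` (blockwise),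
the blocks of `z = w ∘ ε` are `x = second block of w`, `y = first block of w`, `θ = θ`.
[folklore] -/
theorem swapBlocks_blocks (w : Fin (l + k + e) → ℝ) :
    let ε : Fin (k + l + e) ≃ Fin (l + k + e) :=
      finSumFinEquiv.symm.trans ((Equiv.sumCongr (finSumFinEquiv.symm.trans
        ((Equiv.sumComm (Fin k) (Fin l)).trans finSumFinEquiv)) (Equiv.refl (Fin e))).trans finSumFinEquiv)
    (fun i : Fin k => w (ε (Fin.castAdd e (Fin.castAdd l i)))) = (fun i : Fin k => w (Fin.castAdd e (Fin.natAdd l i))) ∧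
      (fun j : Fin l => w (ε (Fin.castAdd e (Fin.natAdd k j)))) = (fun j : Fin l => w (Fin.castAdd e (Fin.castAdd k j))) ∧
      (fun s : Fin e => w (ε (Fin.natAdd (k + l) s))) = (fun s : Fin e => w (Fin.natAdd (l + k) s)) := by
  refine ⟨?_, ?_, ?_⟩ <;> funext i <;>
    simp only [Equiv.trans_apply, finSumFinEquiv_symm_apply_castAdd, finSumFinEquiv_symm_apply_natAdd,
      Equiv.sumCongr_apply, Sum.map_inl, Sum.map_inr, Equiv.sumComm_apply, Sum.swap_inl, Sum.swap_inr,
      finSumFinEquiv_apply_left, finSumFinEquiv_apply_right, Equiv.refl_apply]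

/-- **Exchanging two parameters**: a transposition of two parameter slots leaves the variable
blocks unchanged and swaps the two parameters. [folklore] -/
theorem swap_params_blocks (s₁ s₂ : Fin e) (w : Fin (k + l + e) → ℝ) :
    (fun i : Fin k => w (Equiv.swap (Fin.natAdd (k + l) s₁) (Fin.natAdd (k + l) s₂) (Fin.castAdd e (Fin.castAdd l i)))) =
        (fun i : Fin k => w (Fin.castAdd e (Fin.castAdd l i))) ∧
      (fun j : Fin l => w (Equiv.swap (Fin.natAdd (k + l) s₁) (Fin.natAdd (k + l) s₂) (Fin.castAdd e (Fin.natAdd k j)))) =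
        (fun j : Fin l => w (Fin.castAdd e (Fin.natAdd k j))) ∧
      (fun s : Fin e => w (Equiv.swap (Fin.natAdd (k + l) s₁) (Fin.natAdd (k + l) s₂) (Fin.natAdd (k + l) s))) =
        (fun s : Fin e => w (Fin.natAdd (k + l) (Equiv.swap s₁ s₂ s))) := by
  refine ⟨?_, ?_, ?_⟩
  · funext i
    rw [Equiv.swap_apply_of_ne_of_ne]
    · intro h; have := congrArg Fin.val h; simp at this; omega
    · intro h; have := congrArg Fin.val h; simp at this; omega
  · funext j
    rw [Equiv.swap_apply_of_ne_of_ne]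
    · intro h; have := congrArg Fin.val h; simp at this; omega
    · intro h; have := congrArg Fin.val h; simp at this; omega
  · funext s
    by_cases h₁ : s = s₁
    · subst h₁; rw [Equiv.swap_apply_left, Equiv.swap_apply_left]
    by_cases h₂ : s = s₂
    · subst h₂; rw [Equiv.swap_apply_right, Equiv.swap_apply_right]
    rw [Equiv.swap_apply_of_ne_of_ne, Equiv.swap_apply_of_ne_of_ne h₁ h₂]
    · intro h; exact h₁ (Fin.natAdd_inj _ |>.mp h)
    · intro h; exact h₂ (Fin.natAdd_inj _ |>.mp h)

end Blocks

end CornerBlocks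

/-- **Hook `cornerBlocks_mem_openUnitCube`** (registered form of
`CornerBlocks.comp_equiv_mem_openUnitCube_iff`): membership in the open unit cube is invariant
under coordinate permutations. [folklore] -/
theorem cornerBlocks_mem_openUnitCube : ∀ (a b : ℕ) (ε : Fin a ≃ Fin b) (w : Fin b → ℝ), ((fun i => w (ε i)) ∈ openUnitCube a ↔ w ∈ openUnitCube b) :=
  fun _ _ ε w => CornerBlocks.comp_equiv_mem_openUnitCube_iff ε w

end Summit.KontsevichZagierPeriods.FurushoPentagon.PentagonInKZ
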